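/-
COR-CM (cell pub-hodgecm2, stage 2 of the Hodge ladder) — count-neutral KERNEL COMBINATORICS «split index-two descent, IV: generation of the Hodge
lattice of a split index-two extension — the checklist» (seat prover-pub-hodgecm2-b23-g46-0, binder prover b23, gen 46; claim «SPLIT INDEX-TWO»,
HOME/INBOX.md l.20957).  Theorems only, on top of `Census/IndexTwoSplitCirculation` BY NAME; no `decide`, no certificate, no named fact, no `sorry`;
`Interfaces.lean` (C1), every E term, B01, `Transposition/*`, `PortJoin/*`, `D2Bridge/*` untouched.
HONEST FRAMING: `HC_CM` is NOT proved, here or anywhere in the tree; nothing here is a period, a count of record or a headline.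
T5: n/a-class (hypothesis binders: `c * c = 1`, `c ≠ 1`, `c` central, `c ∈ H`, `H.index = 2`, `x ∉ H`, `x * x = 1`); checker: self.
-/
import Summits.HodgeConjecture.CorCM.Census.IndexTwoSplitCirculation

/-!
# Split index-two descent, IV: generation of the Hodge lattice of a split index-two extension

Setting of parts I–III (`c ≠ 1` a central involution of the finite group `G`, `H ∋ c` of index two, `x ∉ H`).  Assembling
`Census/IndexTwoLifting` (lifts of an `H`-generating family), part I (`IndexTwoSplitDistance`: distance descent), part II
(`IndexTwoSplitResidual`: vanishing lemma) and part III (`IndexTwoSplitCirculation`: residual circulations = two-cycle faces + square elements):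

* §1 **SPLIT INDEX-TWO GENERATION** (`hodgeSpan_le_lifts_descending_twoCycle`, face form `exists_lifts_hodgeSpan_le_descending_twoCycle`):
  `hodgeSpan (G, c)` is generated by the pairs, the lifts `𝓕` of an `H`-generating family (`|𝓕| ≤ |S|`), the DISTANCE-LOWERING MIXED FACES
  and the TWO-CYCLE FACES (no splitting hypothesis needed for this form);
* §2 **THE CHECKLIST** (split case `x·x = 1`; `descent_hyp_of_blockwise`, `hodgeSpan_le_of_checklist`): a base-change-stable `N ≤ hodgeSpan (G, c)`
  containing the pairs is ALL of `hodgeSpan (G, c)` as soon as it holds (1) a lift of every member of an `H`-generating family, (2) for every type of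
  distance `≥ 2` a distance-lowering mixed face at SOME base change of it (one per block), (3) every two-cycle face, (4) every square element.
  This is the form the census of a split family (`D(H)`, `K × ℤ/2`, `M_{2^k}`, `SD_{2^k}`, …) starts from: items (1)–(2) cost `μ(H) + #{blocks of
  distance ≥ 2}` faces, and the law `μ(G) = β(G) − 2 + d₂` (design note `HOME/pub-hodgecm2-b23/SPLIT-INDEX-TWO.md`) is the statement that items
  (3)–(4) cost `B₀ + B₁ − 2 + d₂ − μ(H)` further faces.

## References
* [Pohlmann1968] H. Pohlmann, Algebraic cycles on abelian varieties of complex multiplication type, Ann. of Math. 88 (1968), Thm 1.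
-/

namespace Summit.HodgeConjecture.CorCM.Census.IndexTwoDescent

open Finset
open Summit.HodgeConjecture.CorCM.Prior.AllgGroup.RfwfAllgGroup
open Summit.HodgeConjecture.CorCM.Census.BlockParity
open Summit.HodgeConjecture.CorCM.Census.Coinvariant
open Summit.HodgeConjecture.CorCM.Census.ComplementFaces

noncomputable section

variable {G : Type*} [Group G] [Fintype G] [DecidableEq G] {c : G}
variable {H : Subgroup G} [DecidablePred (· ∈ H)]

/-! ## §1 Split index-two generation -/

/-- **SPLIT INDEX-TWO GENERATION.**  For every central involution `c ≠ 1`, every subgroup `H ∋ c` of index two and every `x ∉ H`: if the Hodge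
lattice of `(H, c)` is generated modulo pairs by the base changes of `S`, and `M ≤ hodgeSpan (G, c)` is a base-change-stable submodule holding a
lift of every member of `S`, then `hodgeSpan (G, c)` is generated by the pairs, `M`, the DISTANCE-LOWERING MIXED FACES
`gface Ψ d (x·d')` (`d ≠ d'` in `res₁ Ψ ∖ res₀ Ψ`) and the TWO-CYCLE FACES `gface Θ t (x·t)` (`res₁ Θ = res₀ Θ`). [folklore] -/
theorem hodgeSpan_le_lifts_descending_twoCycle (hcH : c ∈ H) (hc2 : c * c = 1) (hc1 : c ≠ 1) (hcen : ∀ g : G, g * c = c * g)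
    (hH : H.index = 2) {x : G} (hx : x ∉ H) (S : Finset (CMF H ⟨c, hcH⟩ →₀ ℤ))
    (hS : hodgeSpan (⟨c, hcH⟩ : H) (csub_mul_csub hcH hc2) ≤
      Submodule.span ℤ (pairSet (⟨c, hcH⟩ : H)) ⊔ Submodule.span ℤ (translates (⟨c, hcH⟩ : H) S))
    (M : Submodule ℤ (CMF G c →₀ ℤ)) (hMH : M ≤ hodgeSpan c hc2) (hM : ∀ Q : G, ∀ y ∈ M, Finsupp.mapDomain (rt c Q) y ∈ M)
    (hlift : ∀ f ∈ S, ∃ F ∈ M, marg₀ hcH F = f ∧ marg₁ hcH hcen x F = 0) :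
    hodgeSpan c hc2 ≤ ((Submodule.span ℤ (pairSet c) ⊔ M) ⊔
      Submodule.span ℤ {y | ∃ (Ψ : CMF G c) (d d' : H), d ∈ (res₁ hcH hcen x Ψ).1 ∧ d ∉ (res₀ hcH Ψ).1 ∧
        d' ∈ (res₁ hcH hcen x Ψ).1 ∧ d' ∉ (res₀ hcH Ψ).1 ∧ d ≠ d' ∧ y = gface c hc2 Ψ (d : G) (x * (d' : G))}) ⊔
      Submodule.span ℤ {y | ∃ (Θ : CMF G c) (t : H), res₁ hcH hcen x Θ = res₀ hcH Θ ∧ y = gface c hc2 Θ (t : G) (x * (t : G))} := by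
  set L := Submodule.span ℤ {y | ∃ (Ψ : CMF G c) (d d' : H), d ∈ (res₁ hcH hcen x Ψ).1 ∧ d ∉ (res₀ hcH Ψ).1 ∧
        d' ∈ (res₁ hcH hcen x Ψ).1 ∧ d' ∉ (res₀ hcH Ψ).1 ∧ d ≠ d' ∧ y = gface c hc2 Ψ (d : G) (x * (d' : G))} with hL
  have hLZ : L ≤ LinearMap.ker (marg₀ hcH) ⊓ LinearMap.ker (marg₁ hcH hcen x) := by
    rw [hL, Submodule.span_le]
    rintro _ ⟨Ψ, d, d', -, -, -, -, -, rfl⟩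
    exact ⟨LinearMap.mem_ker.mpr (marg₀_gface_coe_mul hcH hcen hc2 hx Ψ d d'), LinearMap.mem_ker.mpr (marg₁_gface_coe_mul hcH hcen hc2 hx Ψ d d')⟩
  have hLd : ∀ Ψ : CMF G c, 2 ≤ wt (⟨c, hcH⟩ : H) (res₁ hcH hcen x Ψ) (res₀ hcH Ψ) → ∃ t t' : G, gface c hc2 Ψ t t' ∈ L ∧
      wt (⟨c, hcH⟩ : H) (res₁ hcH hcen x (oflipCM c hc2 t Ψ)) (res₀ hcH (oflipCM c hc2 t Ψ)) <
        wt (⟨c, hcH⟩ : H) (res₁ hcH hcen x Ψ) (res₀ hcH Ψ) ∧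
      wt (⟨c, hcH⟩ : H) (res₁ hcH hcen x (oflipCM c hc2 t' Ψ)) (res₀ hcH (oflipCM c hc2 t' Ψ)) <
        wt (⟨c, hcH⟩ : H) (res₁ hcH hcen x Ψ) (res₀ hcH Ψ) ∧
      wt (⟨c, hcH⟩ : H) (res₁ hcH hcen x (oflipCM c hc2 t (oflipCM c hc2 t' Ψ))) (res₀ hcH (oflipCM c hc2 t (oflipCM c hc2 t' Ψ))) <
        wt (⟨c, hcH⟩ : H) (res₁ hcH hcen x Ψ) (res₀ hcH Ψ) := by
    intro Ψ h2
    obtain ⟨d, d', hd1, hd0, hd'1, hd'0, hne, e1, e2, e3⟩ := exists_descending_mixed hcH hcen hc2 hx Ψ h2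
    exact ⟨d, x * (d' : G), by rw [hL]; exact Submodule.subset_span ⟨Ψ, d, d', hd1, hd0, hd'1, hd'0, hne, rfl⟩,
      by omega, by omega, by omega⟩
  refine le_trans (hodgeSpan_le_of_lifts_of_descent hcH hc2 hc1 hcen hH hx S hS M hMH hM hlift L hLZ hLd) (sup_le le_sup_left ?_)
  rintro z ⟨hzZ, hzs⟩
  have hsupp : ∀ Θ ∈ z.support, wt (⟨c, hcH⟩ : H) (res₁ hcH hcen x Θ) (res₀ hcH Θ) ≤ 1 := fun Θ hΘ =>
    (Finsupp.mem_supported ℤ z).mp hzs (Finset.mem_coe.mpr hΘ)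
  have hz := mem_span_twoCycle_sup_square hcH hcen hc2 hc1 hH hx (LinearMap.mem_ker.mp hzZ.1) (LinearMap.mem_ker.mp hzZ.2) hsupp
  -- squares are differences of two distance-lowering faces
  have hsq : Submodule.span ℤ {y | ∃ (Ψ : CMF G c) (k l : H), wt (⟨c, hcH⟩ : H) (res₁ hcH hcen x Ψ) (res₀ hcH Ψ) = 2 ∧
        k ∈ (res₁ hcH hcen x Ψ).1 ∧ k ∉ (res₀ hcH Ψ).1 ∧ l ∈ (res₁ hcH hcen x Ψ).1 ∧ l ∉ (res₀ hcH Ψ).1 ∧ k ≠ l ∧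
        y = gface c hc2 Ψ (k : G) (x * (l : G)) - gface c hc2 Ψ (l : G) (x * (k : G))} ≤ L := by
    rw [hL, Submodule.span_le]
    rintro _ ⟨Ψ, k, l, -, hk1, hk0, hl1, hl0, hkl, rfl⟩
    exact Submodule.sub_mem _ (Submodule.subset_span ⟨Ψ, k, l, hk1, hk0, hl1, hl0, hkl, rfl⟩)
      (Submodule.subset_span ⟨Ψ, l, k, hl1, hl0, hk1, hk0, hkl.symm, rfl⟩)
  obtain ⟨q, hq, r, hr, rfl⟩ := Submodule.mem_sup.mp hz
  exact Submodule.add_mem _ (Submodule.mem_sup_right hq) (Submodule.mem_sup_left (Submodule.mem_sup_right (hsq hr)))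

/-- **SPLIT INDEX-TWO GENERATION, FACE FORM.**  For `S ⊆ gfaceSet (H, c)` finite generating `hodgeSpan (H, c)` modulo pairs there is
`𝓕 ⊆ gfaceSet (G, c)` with `|𝓕| ≤ |S|` such that `hodgeSpan (G, c)` is generated by the pairs, the base changes of `𝓕`, the distance-lowering
mixed faces and the two-cycle faces. [folklore] -/
theorem exists_lifts_hodgeSpan_le_descending_twoCycle (hcH : c ∈ H) (hc2 : c * c = 1) (hc1 : c ≠ 1) (hcen : ∀ g : G, g * c = c * g)
    (hH : H.index = 2) {x : G} (hx : x ∉ H) (S : Finset (CMF H ⟨c, hcH⟩ →₀ ℤ))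
    (hSf : (S : Set (CMF H ⟨c, hcH⟩ →₀ ℤ)) ⊆ gfaceSet H ⟨c, hcH⟩ (csub_mul_csub hcH hc2))
    (hS : hodgeSpan (⟨c, hcH⟩ : H) (csub_mul_csub hcH hc2) ≤
      Submodule.span ℤ (pairSet (⟨c, hcH⟩ : H)) ⊔ Submodule.span ℤ (translates (⟨c, hcH⟩ : H) S)) :
    ∃ 𝓕 : Finset (CMF G c →₀ ℤ), (𝓕 : Set (CMF G c →₀ ℤ)) ⊆ gfaceSet G c hc2 ∧ 𝓕.card ≤ S.card ∧
      hodgeSpan c hc2 ≤ ((Submodule.span ℤ (pairSet c) ⊔ Submodule.span ℤ (translates c 𝓕)) ⊔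
        Submodule.span ℤ {y | ∃ (Ψ : CMF G c) (d d' : H), d ∈ (res₁ hcH hcen x Ψ).1 ∧ d ∉ (res₀ hcH Ψ).1 ∧
          d' ∈ (res₁ hcH hcen x Ψ).1 ∧ d' ∉ (res₀ hcH Ψ).1 ∧ d ≠ d' ∧ y = gface c hc2 Ψ (d : G) (x * (d' : G))}) ⊔
        Submodule.span ℤ {y | ∃ (Θ : CMF G c) (t : H), res₁ hcH hcen x Θ = res₀ hcH Θ ∧ y = gface c hc2 Θ (t : G) (x * (t : G))} := by
  classical
  let L : (CMF H ⟨c, hcH⟩ →₀ ℤ) → (CMF G c →₀ ℤ) := fun f =>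
    if hf : f ∈ gfaceSet H ⟨c, hcH⟩ (csub_mul_csub hcH hc2) then
      gface c hc2 (glue hcH hcen hH hx hf.choose hf.choose) (hf.choose_spec.choose : G) (hf.choose_spec.choose_spec.choose : G)
    else 0
  have hL : ∀ f, (hf : f ∈ gfaceSet H ⟨c, hcH⟩ (csub_mul_csub hcH hc2)) →
      L f ∈ gfaceSet G c hc2 ∧ marg₀ hcH (L f) = f ∧ marg₁ hcH hcen x (L f) = 0 := by
    intro f hf
    have hspec := hf.choose_spec.choose_spec.choose_spec
    simp only [L, dif_pos hf]
    refine ⟨gface_glue_mem_gfaceSet hcH hcen hc2 hH hx _ hspec.1, ?_, marg₁_gface_coe_coe hcH hcen hc2 hx _ _ _⟩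
    rw [marg₀_gface_glue, ← hspec.2]
  refine ⟨S.image L, ?_, Finset.card_image_le, ?_⟩
  · intro F hF
    obtain ⟨f, hf, rfl⟩ := Finset.mem_image.mp (Finset.mem_coe.mp hF)
    exact (hL f (hSf (Finset.mem_coe.mpr hf))).1
  · refine hodgeSpan_le_lifts_descending_twoCycle hcH hc2 hc1 hcen hH hx S hS (Submodule.span ℤ (translates c (S.image L)))
      (span_translates_le_hodgeSpan hc2 _ ?_) (fun Q y hy => TwistGeneration.mapDomain_rt_mem_span_translates c Q _ hy) ?_
    · intro F hF
      obtain ⟨f, hf, rfl⟩ := Finset.mem_image.mp (Finset.mem_coe.mp hF)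
      exact (hL f (hSf (Finset.mem_coe.mpr hf))).1
    · intro f hf
      have h := hL f (hSf (Finset.mem_coe.mpr hf))
      exact ⟨L f, TwistGeneration.mem_span_translates_of_mem c _ (Finset.mem_image_of_mem L hf), h.2.1, h.2.2⟩

/-! ## §2 The checklist (split case): blockwise descending faces -/

/-- **Blockwise descent data suffices** (split case `x·x = 1`): if `L` is base-change stable and every type of distance `≥ 2` has SOME base change
carrying a distance-lowering mixed face in `L`, then every type of distance `≥ 2` carries a distance-lowering face in `L ⊓ Z`. [folklore] -/
theorem descent_hyp_of_blockwise (hcH : c ∈ H) (hcen : ∀ g : G, g * c = c * g) (hc2 : c * c = 1) (hH : H.index = 2) {x : G} (hx : x ∉ H)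
    (hxx : x * x = 1) (L : Submodule ℤ (CMF G c →₀ ℤ)) (hLrt : ∀ Q : G, ∀ y ∈ L, Finsupp.mapDomain (rt c Q) y ∈ L)
    (hblk : ∀ Ψ : CMF G c, 2 ≤ wt (⟨c, hcH⟩ : H) (res₁ hcH hcen x Ψ) (res₀ hcH Ψ) → ∃ (Q : G) (d d' : H),
      gface c hc2 (rt c Q Ψ) (d : G) (x * (d' : G)) ∈ L ∧
      wt (⟨c, hcH⟩ : H) (res₁ hcH hcen x (oflipCM c hc2 (d : G) (rt c Q Ψ))) (res₀ hcH (oflipCM c hc2 (d : G) (rt c Q Ψ))) <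
        wt (⟨c, hcH⟩ : H) (res₁ hcH hcen x (rt c Q Ψ)) (res₀ hcH (rt c Q Ψ)) ∧
      wt (⟨c, hcH⟩ : H) (res₁ hcH hcen x (oflipCM c hc2 (x * (d' : G)) (rt c Q Ψ))) (res₀ hcH (oflipCM c hc2 (x * (d' : G)) (rt c Q Ψ))) <
        wt (⟨c, hcH⟩ : H) (res₁ hcH hcen x (rt c Q Ψ)) (res₀ hcH (rt c Q Ψ)) ∧
      wt (⟨c, hcH⟩ : H) (res₁ hcH hcen x (oflipCM c hc2 (d : G) (oflipCM c hc2 (x * (d' : G)) (rt c Q Ψ))))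
          (res₀ hcH (oflipCM c hc2 (d : G) (oflipCM c hc2 (x * (d' : G)) (rt c Q Ψ)))) <
        wt (⟨c, hcH⟩ : H) (res₁ hcH hcen x (rt c Q Ψ)) (res₀ hcH (rt c Q Ψ)))
    (Ψ : CMF G c) (h2 : 2 ≤ wt (⟨c, hcH⟩ : H) (res₁ hcH hcen x Ψ) (res₀ hcH Ψ)) :
    ∃ t t' : G, gface c hc2 Ψ t t' ∈ L ⊓ (LinearMap.ker (marg₀ hcH) ⊓ LinearMap.ker (marg₁ hcH hcen x)) ∧
      wt (⟨c, hcH⟩ : H) (res₁ hcH hcen x (oflipCM c hc2 t Ψ)) (res₀ hcH (oflipCM c hc2 t Ψ)) <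
        wt (⟨c, hcH⟩ : H) (res₁ hcH hcen x Ψ) (res₀ hcH Ψ) ∧
      wt (⟨c, hcH⟩ : H) (res₁ hcH hcen x (oflipCM c hc2 t' Ψ)) (res₀ hcH (oflipCM c hc2 t' Ψ)) <
        wt (⟨c, hcH⟩ : H) (res₁ hcH hcen x Ψ) (res₀ hcH Ψ) ∧
      wt (⟨c, hcH⟩ : H) (res₁ hcH hcen x (oflipCM c hc2 t (oflipCM c hc2 t' Ψ))) (res₀ hcH (oflipCM c hc2 t (oflipCM c hc2 t' Ψ))) <
        wt (⟨c, hcH⟩ : H) (res₁ hcH hcen x Ψ) (res₀ hcH Ψ) := by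
  obtain ⟨Q, d, d', hmem, e1, e2, e3⟩ := hblk Ψ h2
  -- pull the face back along `Q⁻¹`
  obtain ⟨hface, f1, f2, f3⟩ := descends_rt hcH hcen hc2 hH hx hxx Q⁻¹ (rt c Q Ψ) (d : G) (x * (d' : G))
  rw [rt_inv_rt] at hface f1 f2 f3
  have hD : wt (⟨c, hcH⟩ : H) (res₁ hcH hcen x (rt c Q Ψ)) (res₀ hcH (rt c Q Ψ)) =
      wt (⟨c, hcH⟩ : H) (res₁ hcH hcen x Ψ) (res₀ hcH Ψ) := wt_res_rt hcH hcen hc2 hH hx hxx Q Ψ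
  refine ⟨(d : G) * Q⁻¹⁻¹, x * (d' : G) * Q⁻¹⁻¹, ⟨?_, ?_⟩, ?_, ?_, ?_⟩
  · rw [← hface]; exact hLrt Q⁻¹ _ hmem
  · rw [← hface]
    exact mapDomain_rt_mem_ker_inf_ker hcH hcen hc2 hH hx Ψ Q⁻¹
      ⟨LinearMap.mem_ker.mpr (marg₀_gface_coe_mul hcH hcen hc2 hx _ d d'),
        LinearMap.mem_ker.mpr (marg₁_gface_coe_mul hcH hcen hc2 hx _ d d')⟩
  · rw [f1, ← hD]; exact e1
  · rw [f2, ← hD]; exact e2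
  · rw [f3, ← hD]; exact e3

/-- **THE CHECKLIST** (split case `x·x = 1`).  A base-change-stable submodule `N ≤ hodgeSpan (G, c)` containing the pairs IS the whole Hodge
lattice as soon as: (1) it holds a lift of every member of an `H`-generating family `S`; (2) every type of distance `≥ 2` has some base change
carrying a distance-lowering mixed face in `N` (one per block suffices); (3) it holds every two-cycle face; (4) it holds every square element.
[folklore] -/
theorem hodgeSpan_le_of_checklist (hcH : c ∈ H) (hc2 : c * c = 1) (hc1 : c ≠ 1) (hcen : ∀ g : G, g * c = c * g) (hH : H.index = 2)
    {x : G} (hx : x ∉ H) (hxx : x * x = 1) (S : Finset (CMF H ⟨c, hcH⟩ →₀ ℤ))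
    (hS : hodgeSpan (⟨c, hcH⟩ : H) (csub_mul_csub hcH hc2) ≤
      Submodule.span ℤ (pairSet (⟨c, hcH⟩ : H)) ⊔ Submodule.span ℤ (translates (⟨c, hcH⟩ : H) S))
    (N : Submodule ℤ (CMF G c →₀ ℤ)) (hNH : N ≤ hodgeSpan c hc2) (hN : ∀ Q : G, ∀ y ∈ N, Finsupp.mapDomain (rt c Q) y ∈ N)
    (hP : Submodule.span ℤ (pairSet c) ≤ N)
    (hlift : ∀ f ∈ S, ∃ F ∈ N, marg₀ hcH F = f ∧ marg₁ hcH hcen x F = 0)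
    (hblk : ∀ Ψ : CMF G c, 2 ≤ wt (⟨c, hcH⟩ : H) (res₁ hcH hcen x Ψ) (res₀ hcH Ψ) → ∃ (Q : G) (d d' : H),
      gface c hc2 (rt c Q Ψ) (d : G) (x * (d' : G)) ∈ N ∧
      wt (⟨c, hcH⟩ : H) (res₁ hcH hcen x (oflipCM c hc2 (d : G) (rt c Q Ψ))) (res₀ hcH (oflipCM c hc2 (d : G) (rt c Q Ψ))) <
        wt (⟨c, hcH⟩ : H) (res₁ hcH hcen x (rt c Q Ψ)) (res₀ hcH (rt c Q Ψ)) ∧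
      wt (⟨c, hcH⟩ : H) (res₁ hcH hcen x (oflipCM c hc2 (x * (d' : G)) (rt c Q Ψ))) (res₀ hcH (oflipCM c hc2 (x * (d' : G)) (rt c Q Ψ))) <
        wt (⟨c, hcH⟩ : H) (res₁ hcH hcen x (rt c Q Ψ)) (res₀ hcH (rt c Q Ψ)) ∧
      wt (⟨c, hcH⟩ : H) (res₁ hcH hcen x (oflipCM c hc2 (d : G) (oflipCM c hc2 (x * (d' : G)) (rt c Q Ψ))))
          (res₀ hcH (oflipCM c hc2 (d : G) (oflipCM c hc2 (x * (d' : G)) (rt c Q Ψ)))) <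
        wt (⟨c, hcH⟩ : H) (res₁ hcH hcen x (rt c Q Ψ)) (res₀ hcH (rt c Q Ψ)))
    (hq : ∀ (Θ : CMF G c) (t : H), res₁ hcH hcen x Θ = res₀ hcH Θ → gface c hc2 Θ (t : G) (x * (t : G)) ∈ N)
    (hr : ∀ (Ψ : CMF G c) (k l : H), wt (⟨c, hcH⟩ : H) (res₁ hcH hcen x Ψ) (res₀ hcH Ψ) = 2 →
      k ∈ (res₁ hcH hcen x Ψ).1 → k ∉ (res₀ hcH Ψ).1 → l ∈ (res₁ hcH hcen x Ψ).1 → l ∉ (res₀ hcH Ψ).1 → k ≠ l →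
      gface c hc2 Ψ (k : G) (x * (l : G)) - gface c hc2 Ψ (l : G) (x * (k : G)) ∈ N) :
    hodgeSpan c hc2 ≤ N := by
  set L := N ⊓ (LinearMap.ker (marg₀ hcH) ⊓ LinearMap.ker (marg₁ hcH hcen x)) with hL
  have hmain := hodgeSpan_le_of_lifts_of_descent hcH hc2 hc1 hcen hH hx S hS N hNH hN hlift L inf_le_right
    (descent_hyp_of_blockwise hcH hcen hc2 hH hx hxx N hN hblk)
  refine le_trans hmain (sup_le (sup_le (sup_le hP le_rfl) inf_le_left) ?_)
  rintro z ⟨hzZ, hzs⟩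
  have hsupp : ∀ Θ ∈ z.support, wt (⟨c, hcH⟩ : H) (res₁ hcH hcen x Θ) (res₀ hcH Θ) ≤ 1 := fun Θ hΘ =>
    (Finsupp.mem_supported ℤ z).mp hzs (Finset.mem_coe.mpr hΘ)
  have hz := mem_span_twoCycle_sup_square hcH hcen hc2 hc1 hH hx (LinearMap.mem_ker.mp hzZ.1) (LinearMap.mem_ker.mp hzZ.2) hsupp
  have hle : Submodule.span ℤ {y | ∃ (Θ : CMF G c) (t : H), res₁ hcH hcen x Θ = res₀ hcH Θ ∧ y = gface c hc2 Θ (t : G) (x * (t : G))} ⊔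
      Submodule.span ℤ {y | ∃ (Ψ : CMF G c) (k l : H), wt (⟨c, hcH⟩ : H) (res₁ hcH hcen x Ψ) (res₀ hcH Ψ) = 2 ∧
        k ∈ (res₁ hcH hcen x Ψ).1 ∧ k ∉ (res₀ hcH Ψ).1 ∧ l ∈ (res₁ hcH hcen x Ψ).1 ∧ l ∉ (res₀ hcH Ψ).1 ∧ k ≠ l ∧
        y = gface c hc2 Ψ (k : G) (x * (l : G)) - gface c hc2 Ψ (l : G) (x * (k : G))} ≤ N := by
    refine sup_le (Submodule.span_le.mpr ?_) (Submodule.span_le.mpr ?_)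
    · rintro _ ⟨Θ, t, hΘ, rfl⟩; exact hq Θ t hΘ
    · rintro _ ⟨Ψ, k, l, h2, hk1, hk0, hl1, hl0, hkl, rfl⟩; exact hr Ψ k l h2 hk1 hk0 hl1 hl0 hkl
  exact hle hz

/-! ## §3 The counted checklist: `μ(G) ≤ μ(H) + #{blocks of distance ≥ 2} + #{closing faces}` -/

/-- **One distance-lowering mixed face per block of distance `≥ 2`** (split case): there is a family `𝒟` of mixed faces, at most one per block of
distance `≥ 2`, such that every type of distance `≥ 2` has a base change carrying a distance-lowering member of `𝒟`. [folklore] -/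
theorem exists_blockwise_descending_family (hcH : c ∈ H) (hcen : ∀ g : G, g * c = c * g) (hc2 : c * c = 1) (hH : H.index = 2)
    {x : G} (hx : x ∉ H) (hxx : x * x = 1) :
    ∃ 𝒟 : Finset (CMF G c →₀ ℤ), (𝒟 : Set (CMF G c →₀ ℤ)) ⊆ mixedSet c hc2 H x ∧
      𝒟.card ≤ (Finset.univ.filter fun b : Block c =>
        2 ≤ wt (⟨c, hcH⟩ : H) (res₁ hcH hcen x b.out) (res₀ hcH b.out)).card ∧
      ∀ Ψ : CMF G c, 2 ≤ wt (⟨c, hcH⟩ : H) (res₁ hcH hcen x Ψ) (res₀ hcH Ψ) → ∃ (Q : G) (d d' : H),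
        gface c hc2 (rt c Q Ψ) (d : G) (x * (d' : G)) ∈ 𝒟 ∧
        wt (⟨c, hcH⟩ : H) (res₁ hcH hcen x (oflipCM c hc2 (d : G) (rt c Q Ψ))) (res₀ hcH (oflipCM c hc2 (d : G) (rt c Q Ψ))) <
          wt (⟨c, hcH⟩ : H) (res₁ hcH hcen x (rt c Q Ψ)) (res₀ hcH (rt c Q Ψ)) ∧
        wt (⟨c, hcH⟩ : H) (res₁ hcH hcen x (oflipCM c hc2 (x * (d' : G)) (rt c Q Ψ))) (res₀ hcH (oflipCM c hc2 (x * (d' : G)) (rt c Q Ψ))) <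
          wt (⟨c, hcH⟩ : H) (res₁ hcH hcen x (rt c Q Ψ)) (res₀ hcH (rt c Q Ψ)) ∧
        wt (⟨c, hcH⟩ : H) (res₁ hcH hcen x (oflipCM c hc2 (d : G) (oflipCM c hc2 (x * (d' : G)) (rt c Q Ψ))))
            (res₀ hcH (oflipCM c hc2 (d : G) (oflipCM c hc2 (x * (d' : G)) (rt c Q Ψ)))) <
          wt (⟨c, hcH⟩ : H) (res₁ hcH hcen x (rt c Q Ψ)) (res₀ hcH (rt c Q Ψ)) := by
  classical
  -- the chosen face at (the representative of) a block of distance ≥ 2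
  let D : CMF G c → ℕ := fun Ψ => wt (⟨c, hcH⟩ : H) (res₁ hcH hcen x Ψ) (res₀ hcH Ψ)
  let f : Block c → (CMF G c →₀ ℤ) := fun b =>
    if h : 2 ≤ D b.out then
      gface c hc2 b.out ((exists_descending_mixed hcH hcen hc2 hx b.out h).choose : G)
        (x * ((exists_descending_mixed hcH hcen hc2 hx b.out h).choose_spec.choose : G))
    else 0
  refine ⟨(Finset.univ.filter fun b : Block c => 2 ≤ D b.out).image f, ?_, Finset.card_image_le, ?_⟩
  · intro y hy
    obtain ⟨b, hb, rfl⟩ := Finset.mem_image.mp (Finset.mem_coe.mp hy)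
    have h2 : 2 ≤ D b.out := (Finset.mem_filter.mp hb).2
    simp only [f, dif_pos h2]
    exact ⟨_, _, _, rfl⟩
  · intro Ψ hΨ
    set b := blk c Ψ with hb
    have hbo : blk c b.out = b := Quotient.out_eq b
    obtain ⟨Q, hQ⟩ := exists_rt_eq_of_blk_eq c (hbo.symm ▸ rfl : blk c Ψ = blk c b.out)
    have h2 : 2 ≤ D b.out := by
      have e := wt_res_eq_of_blk_eq hcH hcen hc2 hH hx hxx (hbo.symm ▸ rfl : blk c Ψ = blk c b.out)
      show 2 ≤ wt (⟨c, hcH⟩ : H) (res₁ hcH hcen x b.out) (res₀ hcH b.out)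
      rw [← e]; exact hΨ
    have hspec := (exists_descending_mixed hcH hcen hc2 hx b.out h2).choose_spec.choose_spec
    obtain ⟨hd1, hd0, hd'1, hd'0, hne, e1, e2, e3⟩ := hspec
    refine ⟨Q, (exists_descending_mixed hcH hcen hc2 hx b.out h2).choose,
      (exists_descending_mixed hcH hcen hc2 hx b.out h2).choose_spec.choose, ?_, ?_, ?_, ?_⟩
    · rw [hQ]
      refine Finset.mem_image.mpr ⟨b, Finset.mem_filter.mpr ⟨Finset.mem_univ _, h2⟩, ?_⟩
      simp only [f, dif_pos h2]
    · rw [hQ]; omega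
    · rw [hQ]; omega
    · rw [hQ]; omega

/-- **THE COUNTED CHECKLIST** (split case): there are face families `𝓕` (lifts, `|𝓕| ≤ |S|`) and `𝒟` (distance-lowering mixed faces,
`|𝒟| ≤ #{blocks of distance ≥ 2}`) such that for EVERY further face family `C`: if the two-cycle faces and the square elements lie in
`ℤ⟨pairs⟩ ⊔ ℤ[G]·(𝓕 ∪ 𝒟 ∪ C)`, then so does the whole Hodge lattice — **`μ(G, c) ≤ μ(H, c) + #{blocks of distance ≥ 2} + |C|`**. [folklore] -/
theorem exists_counted_checklist (hcH : c ∈ H) (hc2 : c * c = 1) (hc1 : c ≠ 1) (hcen : ∀ g : G, g * c = c * g) (hH : H.index = 2)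
    {x : G} (hx : x ∉ H) (hxx : x * x = 1) (S : Finset (CMF H ⟨c, hcH⟩ →₀ ℤ))
    (hSf : (S : Set (CMF H ⟨c, hcH⟩ →₀ ℤ)) ⊆ gfaceSet H ⟨c, hcH⟩ (csub_mul_csub hcH hc2))
    (hS : hodgeSpan (⟨c, hcH⟩ : H) (csub_mul_csub hcH hc2) ≤
      Submodule.span ℤ (pairSet (⟨c, hcH⟩ : H)) ⊔ Submodule.span ℤ (translates (⟨c, hcH⟩ : H) S)) :
    ∃ 𝓕 𝒟 : Finset (CMF G c →₀ ℤ), (𝓕 : Set (CMF G c →₀ ℤ)) ⊆ gfaceSet G c hc2 ∧ (𝒟 : Set (CMF G c →₀ ℤ)) ⊆ gfaceSet G c hc2 ∧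
      𝓕.card ≤ S.card ∧
      𝒟.card ≤ (Finset.univ.filter fun b : Block c => 2 ≤ wt (⟨c, hcH⟩ : H) (res₁ hcH hcen x b.out) (res₀ hcH b.out)).card ∧
      ∀ C : Finset (CMF G c →₀ ℤ), (C : Set (CMF G c →₀ ℤ)) ⊆ gfaceSet G c hc2 →
        (∀ (Θ : CMF G c) (t : H), res₁ hcH hcen x Θ = res₀ hcH Θ →
          gface c hc2 Θ (t : G) (x * (t : G)) ∈ Submodule.span ℤ (pairSet c) ⊔ Submodule.span ℤ (translates c (𝓕 ∪ 𝒟 ∪ C))) →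
        (∀ (Ψ : CMF G c) (k l : H), wt (⟨c, hcH⟩ : H) (res₁ hcH hcen x Ψ) (res₀ hcH Ψ) = 2 →
          k ∈ (res₁ hcH hcen x Ψ).1 → k ∉ (res₀ hcH Ψ).1 → l ∈ (res₁ hcH hcen x Ψ).1 → l ∉ (res₀ hcH Ψ).1 → k ≠ l →
          gface c hc2 Ψ (k : G) (x * (l : G)) - gface c hc2 Ψ (l : G) (x * (k : G)) ∈
            Submodule.span ℤ (pairSet c) ⊔ Submodule.span ℤ (translates c (𝓕 ∪ 𝒟 ∪ C))) →
        hodgeSpan c hc2 ≤ Submodule.span ℤ (pairSet c) ⊔ Submodule.span ℤ (translates c (𝓕 ∪ 𝒟 ∪ C)) := by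
  classical
  -- lifts
  let L : (CMF H ⟨c, hcH⟩ →₀ ℤ) → (CMF G c →₀ ℤ) := fun f =>
    if hf : f ∈ gfaceSet H ⟨c, hcH⟩ (csub_mul_csub hcH hc2) then
      gface c hc2 (glue hcH hcen hH hx hf.choose hf.choose) (hf.choose_spec.choose : G) (hf.choose_spec.choose_spec.choose : G)
    else 0
  have hL : ∀ f, (hf : f ∈ gfaceSet H ⟨c, hcH⟩ (csub_mul_csub hcH hc2)) →
      L f ∈ gfaceSet G c hc2 ∧ marg₀ hcH (L f) = f ∧ marg₁ hcH hcen x (L f) = 0 := by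
    intro f hf
    have hspec := hf.choose_spec.choose_spec.choose_spec
    simp only [L, dif_pos hf]
    refine ⟨gface_glue_mem_gfaceSet hcH hcen hc2 hH hx _ hspec.1, ?_, marg₁_gface_coe_coe hcH hcen hc2 hx _ _ _⟩
    rw [marg₀_gface_glue, ← hspec.2]
  obtain ⟨𝒟, h𝒟m, h𝒟c, h𝒟⟩ := exists_blockwise_descending_family hcH hcen hc2 hH hx hxx
  have h𝒟f : (𝒟 : Set (CMF G c →₀ ℤ)) ⊆ gfaceSet G c hc2 := fun y hy => mixedSet_subset_gfaceSet hcH hc2 hx (h𝒟m hy)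
  refine ⟨S.image L, 𝒟, ?_, h𝒟f, Finset.card_image_le, h𝒟c, fun C hC hq hr => ?_⟩
  · intro F hF
    obtain ⟨f, hf, rfl⟩ := Finset.mem_image.mp (Finset.mem_coe.mp hF)
    exact (hL f (hSf (Finset.mem_coe.mpr hf))).1
  have hUf : ((S.image L ∪ 𝒟 ∪ C : Finset _) : Set (CMF G c →₀ ℤ)) ⊆ gfaceSet G c hc2 := by
    intro y hy
    rcases Finset.mem_union.mp (Finset.mem_coe.mp hy) with hy | hy
    · rcases Finset.mem_union.mp hy with hy | hy
      · obtain ⟨f, hf, rfl⟩ := Finset.mem_image.mp hy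
        exact (hL f (hSf (Finset.mem_coe.mpr hf))).1
      · exact h𝒟f (Finset.mem_coe.mpr hy)
    · exact hC (Finset.mem_coe.mpr hy)
  set N := Submodule.span ℤ (pairSet c) ⊔ Submodule.span ℤ (translates c (S.image L ∪ 𝒟 ∪ C)) with hN
  have hNH : N ≤ hodgeSpan c hc2 := sup_le le_sup_right (span_translates_le_hodgeSpan hc2 _ hUf)
  have hNrt : ∀ Q : G, ∀ y ∈ N, Finsupp.mapDomain (rt c Q) y ∈ N := fun Q y hy => TwistGeneration.mapDomain_rt_mem_psp c hcen Q _ hy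
  refine hodgeSpan_le_of_checklist hcH hc2 hc1 hcen hH hx hxx S hS N hNH hNrt le_sup_left ?_ ?_ hq hr
  · intro f hf
    have h := hL f (hSf (Finset.mem_coe.mpr hf))
    refine ⟨L f, Submodule.mem_sup_right (TwistGeneration.mem_span_translates_of_mem c _ ?_), h.2.1, h.2.2⟩
    exact Finset.mem_union_left _ (Finset.mem_union_left _ (Finset.mem_image_of_mem L hf))
  · intro Ψ hΨ
    obtain ⟨Q, d, d', hmem, e1, e2, e3⟩ := h𝒟 Ψ hΨ
    refine ⟨Q, d, d', Submodule.mem_sup_right (TwistGeneration.mem_span_translates_of_mem c _ ?_), e1, e2, e3⟩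
    exact Finset.mem_union_left _ (Finset.mem_union_right _ hmem)

end

end Summit.HodgeConjecture.CorCM.Census.IndexTwoDescent
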